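import Literature.AnabelianGeometry.SemiGraphs.FundamentalGroupImmersions
import Literature.AnabelianGeometry.SemiGraphs.SchreierCoreGraph
import HarnessLib

/-!
# [SemiAnbd] Corollary 1.6 (i) (A. Tamagawa): realising `F ↪ G` by an immersion of finite graphs

Proof-only companion to `Literature/AnabelianGeometry/SemiGraphs/FundamentalGroup.lean`
(abc-iut cell, layer L3, node SemiAnbd:Cor1.6(i), discharge item G15).  It discharges the named fact
`SemiGraph.corollary_1_6_i` (Mochizuki, *Semi-graphs of anabelioids*, Publ. RIMS 42 (2006),
Cor. 1.6 (i), p. 19: for a finitely generated subgroup `F` of a free group `G` of finite rank "there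
exists an immersion of finite graphs `G_A → G_B` whose induced morphism on (topological) fundamental
groups is isomorphic to the inclusion `F ↪ G`") by the classical Stallings/Serre construction:
`G_B` = the bouquet on a free basis of `G` (`Rose.lean`), `G_A` = the finite core of the Schreier
coset graph of `F` (`SchreierCoreGraph.lean`), `G_A → G_B` the forgetful immersion; its injectivity
on `π₁` is `FundamentalGroupImmersions.lean`, its image is `F` by the coset bookkeeping of
`SchreierCoreGraph.lean`.  No side is taken on [IUTchIII] Cor. 3.12; this is classical.
-/

namespace Literature.AnabelianGeometry.SemiGraphs

namespace SemiGraph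

open CategoryTheory Quiver
open Literature.GroupTheory.CombinatorialGroupTheory
open Literature.GroupTheory.CombinatorialGroupTheory.FreeGroupoidWords

universe u

/-- **[SemiAnbd] Corollary 1.6 (i)** (discharge of the named fact `corollary_1_6_i`).
[cite: MochizukiSemiAnbd2006, Cor. 1.6(i) p.19] -/
theorem corollary_1_6_i_holds : corollary_1_6_i.{u} := by
  intro Γ _ ι _ bΓ F hF
  classical
  obtain ⟨S, rfl⟩ := hF
  -- the data
  let A := coreGraph bΓ S
  let φ : coreGraph bΓ S ⟶ rose ι := coreToRose bΓ S
  let a : (coreGraph bΓ S).Vertex := SchreierCore.v₀ bΓ S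
  have hφ : IsImmersion φ := coreToRose_isImmersion bΓ S
  -- the label homomorphism of `G_A`: `π₁(G_A, a) → π₁(G_B, ⋆) → Γ`
  let ψA : (coreGraph bΓ S).FundamentalGroup (Sum.inl a) →* Γ :=
    (Rose.labelHom bΓ).comp (Hom.mapFundamentalGroup φ (Sum.inl a))
  have hψA : ∀ p : Path (SchreierCore.vObj (SchreierCore.v₀ bΓ S))
      (SchreierCore.vObj (SchreierCore.v₀ bΓ S)),
      ψA (homMk (V := (coreGraph bΓ S).CatCarrier) p) =
        (Rose.pathLabel bΓ ((Hom.catPrefunctor φ).symmetrify.mapPath p))⁻¹ := by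
    intro p
    change Rose.labelHom bΓ ((Hom.mapFundamentalGroupoid φ).map (homMk p)) = _
    rw [mapFundamentalGroupoid_map_homMk]
    exact Rose.labelHom_cls_eq bΓ _
  have hinj : Function.Injective ψA :=
    (Rose.labelHom_bijective bΓ).1.comp (hφ.mapFundamentalGroup_injective (Sum.inl a))
  have hrange : ψA.range = Subgroup.closure (S : Set Γ) := by
    refine le_antisymm ?_ ((Subgroup.closure_le _).mpr fun g hg => ?_)
    · rintro _ ⟨x, rfl⟩
      obtain ⟨p, rfl⟩ := homMk_surjective (V := (coreGraph bΓ S).CatCarrier)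
        (X := SchreierCore.vObj (SchreierCore.v₀ bΓ S))
        (Y := SchreierCore.vObj (SchreierCore.v₀ bΓ S)) x
      rw [hψA]
      exact Subgroup.inv_mem _ (SchreierCore.pathLabel_mem bΓ S p)
    · obtain ⟨p, hp⟩ := SchreierCore.exists_closed_path bΓ S hg
      have h1 : ψA (homMk (V := (coreGraph bΓ S).CatCarrier) p) = g⁻¹ := by rw [hψA, hp]
      exact (Subgroup.inv_mem_iff _).mp (h1 ▸ ⟨_, rfl⟩)
  let eA : (coreGraph bΓ S).FundamentalGroup (Sum.inl a) ≃* Subgroup.closure (S : Set Γ) :=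
    (MonoidHom.ofInjective hinj).trans (MulEquiv.subgroupCongr hrange)
  refine ⟨coreGraph bΓ S, rose ι, φ, a, eA, Rose.fundamentalGroupEquiv bΓ,
    coreGraph_isFinite bΓ S, coreGraph_isGraph bΓ S, rose_isFinite ι, rose_isGraph ι, hφ,
    fun x => ?_⟩
  change Rose.labelHom bΓ (Hom.mapFundamentalGroup φ (Sum.inl a) x) =
    ((MonoidHom.ofInjective hinj x : ψA.range) : Γ)
  rw [MonoidHom.ofInjective_apply]
  rfl

end SemiGraph

end Literature.AnabelianGeometry.SemiGraphs
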